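import Literature.Analysis.FluidPDE.StokesTorusBilinearForm
import Literature.Analysis.FluidPDE.StokesTorusSemigroup
import Literature.Analysis.FluidPDE.EnergySpaceTorusHilbertBasisProofs
import Summits.AnomalousDissipation.AnomalousDissipation.Theorems.BaireTransferDenseLoudDesignerForcesErgodicLine

/-!
# A model frame exists (registered tools stub S6₀ of the crux `DenseLoudDesignerForces`, line
# ergodic-budget-selection-closing, block N)

Summit-side assembly (no new mathematics): the data of the structure `ModelFrame` of
`…ErgodicModelDefs.lean` — the Stokes MODE basis of `exists_hilbertBasis_stokes_holds`, the diagonal frame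
`S = (1+A)^{-1/2}`, `T t = e^{-tA}`, `K t = A^{3/4}e^{-tA}` of the basis-parametric core
`exists_semigroupFrame_of_eq_diagonalPMap` (S1) read on THAT basis, and the bounded bilinear form `Nb` of
`Torus.exists_mildBilinearForm` (S3) — packaged as one existential statement with exactly the laws the smooth-model
assembly consumes.
-/

set_option linter.dupNamespace false

noncomputable section

open Filter Set Function MeasureTheory
open scoped InnerProductSpace RealInnerProductSpace Topology

namespace Summit.AnomalousDissipation.AnomalousDissipation.Theorems.DenseLoudDesignerForces.Ergodic

open Literature.Analysis.FunctionSpaces Literature.Analysis.FunctionSpaces.Torus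
open Literature.Analysis.FluidPDE Literature.Analysis.FluidPDE.Torus

/-- **A model frame exists**: the Stokes mode basis `b` of `Hsp` with eigenvalues `0 < m i → ∞` and `A = b.diagonalPMap m`, the
diagonal frame operators `S = (1+A)^{-1/2}`, `T t = e^{-tA}`, `K t = A^{3/4} e^{-tA}` with their contraction / semigroup / continuity /
commutation / smoothing laws, and the bounded bilinear form `Nb` of the mild formulation with its coefficient formula
(`exists_hilbertBasis_stokes_holds` + `exists_semigroupFrame_of_eq_diagonalPMap` + `Torus.exists_mildBilinearForm`). [folklore] -/
theorem stub_modelFrameExistsTools :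
    ∃ (ι : Type) (b : HilbertBasis ι ℝ Hsp) (m : ι → ℝ) (S : Hsp →L[ℝ] Hsp) (T K : ℝ → Hsp →L[ℝ] Hsp) (Nb : Hsp →L[ℝ] Hsp →L[ℝ] Hsp),
      (∀ i, 0 < m i) ∧ Tendsto m cofinite atTop ∧ stokesOperatorH (Fin 3) = b.diagonalPMap m ∧
      (∀ i, ∃ (k : Fin 3 → ℤ) (a : EuclideanSpace ℝ (Fin 3)) (c : Bool), k ≠ 0 ∧ a ≠ 0 ∧ ⟪latticeVec k, a⟫_ℝ = 0 ∧
        ((b i : Hsp) : Lp (EuclideanSpace ℝ (Fin 3)) 2 (volume : Measure (UnitAddTorus (Fin 3)))) = stokesModeL2 k a c ∧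
        m i = stokesEigenvalue k) ∧
      (∀ i, S (b i) = ((1 + m i) ^ (-(1 / 2 : ℝ))) • b i) ∧ Function.Injective S ∧
      (∀ t i, 0 ≤ t → T t (b i) = Real.exp (-(t * m i)) • b i) ∧ (∀ t, 0 ≤ t → ‖T t‖ ≤ 1) ∧ T 0 = 1 ∧
      (∀ s t, 0 ≤ s → 0 ≤ t → T (s + t) = (T s).comp (T t)) ∧ (∀ y : Hsp, Continuous fun t : ℝ => T t y) ∧
      (∀ t, (T t).comp S = S.comp (T t)) ∧ (∀ t, 0 ≤ t → IsSelfAdjoint (T t)) ∧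
      (∀ t i, 0 < t → K t (b i) = ((m i) ^ (3 / 4 : ℝ) * Real.exp (-(t * m i))) • b i) ∧
      (∀ t, 0 < t → ‖K t‖ ≤ t ^ (-(3 / 4 : ℝ))) ∧ (∀ s t, 0 ≤ s → 0 < t → K (s + t) = (T s).comp (K t)) ∧
      (∀ t, (K t).comp S = S.comp (K t)) ∧ (∀ y : Hsp, ContinuousOn (fun t : ℝ => K t y) (Ioi 0)) ∧
      (∀ (y z : Hsp) (i : ι) (k : Fin 3 → ℤ) (a : EuclideanSpace ℝ (Fin 3)) (c : Bool),
        ((b i : Hsp) : Lp (EuclideanSpace ℝ (Fin 3)) 2 (volume : Measure (UnitAddTorus (Fin 3)))) = stokesModeL2 k a c →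
        ⟪Nb y z, b i⟫_ℝ = -((m i) ^ (-(3 / 4 : ℝ)) * (1 + m i) ^ (1 / 2 : ℝ)) *
          ∫ x, ⟪rep (S z) x, convect (rep (S y)) (stokesMode k a c) x⟫_ℝ) := by
  -- the mode basis
  obtain ⟨ι, b, m, hmodes, hpos, htend, hA, -⟩ := exists_hilbertBasis_stokes_holds (d := Fin 3)
  -- the diagonal frame on that basis
  obtain ⟨S, R, T, K, hS, -, hT, hK, -, hSinj, -, -, -, -, -, -, hTnorm, hT0, hTadd, hTc, hTS, hTsa, -, hKnorm, hKadd, hKS,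
    hKc⟩ := exists_semigroupFrame_of_eq_diagonalPMap b (fun i => (hpos i).le) htend hA
  -- the bilinear form
  obtain ⟨Nb, hNb⟩ := exists_mildBilinearForm (Fintype.card_fin 3) ι b m hmodes S hS
  exact ⟨ι, b, m, S, T, K, Nb, hpos, htend, hA, hmodes, hS, hSinj, hT, hTnorm, hT0, hTadd, hTc, hTS, hTsa, hK, hKnorm, hKadd,
    hKS, hKc, hNb⟩

end Summit.AnomalousDissipation.AnomalousDissipation.Theorems.DenseLoudDesignerForces.Ergodic

end
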